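import Mathlib
import HarnessLib
import Summits.NavierStokesRegularity.NavierStokesRegularity.Theorems.UnthreadedDoorNetFluxNF1aDeltaSlice

/-!
# Route `UnthreadedDoor`, crux `PoloidalLiouville` (stmt-NavierStokesRegularity-1222), WALL W1 `stub_scalarLiouville` —
# crux idea «netflux-typei-gap» (ns-idea-14), NF-1a `stub_extremalHeadEMF`: the (Δ) side — (Δii) JOINT CONTINUITY OF THE HEAD DIFFERENCE

KEY-NS #164/#166 division (this seat: conjuncts (ii), (v) of the (Δ) side).  Part (ii) of `ExtremalHeadEMF`: `(t,r) ↦ I(t,r) = P(t,x⁺) − P(t,x⁻)` is continuous on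
`]t₀,0[ × ]0,∞[`.  The head `P(t,·)` is chosen slice by slice with NO regularity in `t`, so `I` is first rewritten WITHOUT `P`:
along any `C¹` path `γ ⊂ S_r(x₀)`, the tangential relation `(∇P − m∇T) × (x − x₀) = 0` (`m = ⟪v, x − x₀⟫`) gives
`P(γ(1)) − P(γ(0)) = ∫₀¹ m(γ) ⟪∇T(γ), γ'⟫` (`headDiff_eq_lineIntegral`).  Taking `γ` = the great circle from `x⁻` to `x⁺`
(`exists_greatCircle`, p660776) and, for `(t',r')` nearby, its radial rescaling to `S_{r'}`, one gets
`I(t',r') = [P_{t'}(x⁺(t',r')) − P_{t'}(x̃⁺)] + J(t',r') + [P_{t'}(x̃⁻) − P_{t'}(x⁻(t',r'))]`, where `J` is a parametric integral with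
jointly continuous integrand (`continuousOn_lineIntegral`) and the END CORRECTIONS are bounded, by the slice level-Lipschitz property with a
constant `L₀ = 2r · sup‖v‖` uniform near `(t,r)`, by `L₀ (max_{S_{r'}}T(t') − T(t',x̃⁺))` and `L₀ (T(t',x̃⁻) − min_{S_{r'}}T(t'))`, which
tend to `0` by the joint continuity of the envelopes (`continuousOn_sphSup_family`, p662790) and of `T`.

HYPOTHESES of the main theorem `continuousOn_headDiff_of_sliceLevelLip`: `v` smooth on the window, `T` smooth off the centre, `P(t,·) ∈ C¹`
off the centre, the tangential relation, the slice level-Lipschitz property in its FLEXIBLE form (any bound `L` of `|⟪v(t,·), · − x₀⟫|` on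
`S_r` is a constant — literally (Λ) `LevelLipschitz` applied to `f = T(t)`, `g = P(t)`, `μ = ⟪v(t,·), · − x₀⟫`; the fixed constant `V(t)·r`
would not do, `V` being arbitrary in `t`), and property (i) of `I`.  Also: `eq_smul_of_cross_eq_zero` (`w × y = 0`, `y ≠ 0` ⇒ `w ∥ y`,
Lagrange), the great-circle calculus (`hasDerivAt_greatCircle`, `norm_greatCircle_sub_center`, `inner_greatCircle_tangent`).

WHAT THIS IS NOT: no NS-regularity statement is touched; helper lemmas for one sub-part of NF-1a, which stays OPEN (its topological/Sard half
is ARM A's), as do `PoloidalLiouville` (1222), W1, the rung target and the summit.  `--supports stmt-NavierStokesRegularity-1222 --as helper`.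
[folklore]
-/

noncomputable section

-- the summit and its single sub-problem share the name (CONVENTIONS §1)
set_option linter.dupNamespace false

open Set Function Filter Topology InnerProductSpace MeasureTheory
open scoped RealInnerProductSpace NNReal

namespace Summit.NavierStokesRegularity.NavierStokesRegularity.Theorems.PoloidalLiouville.NetFlux.NF1a

open Literature.Analysis Literature.Analysis.FluidPDE

variable {v : ℝ → E3 → E3} {T P : ℝ → E3 → ℝ} {x₀ : E3} {t₀ : ℝ}

/-! ### `w × y = 0` with `y ≠ 0` forces `w ∥ y` -/

/-- **Vanishing cross product means parallel**: `w × y = 0`, `y ≠ 0` ⇒ `w = (⟪w,y⟫/⟪y,y⟫) y` (Lagrange's identity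
`‖w × y‖² = ‖w‖²‖y‖² − ⟪w,y⟫²`). [folklore] -/
theorem eq_smul_of_cross_eq_zero {w y : E3} (hy : y ≠ 0) (h : cross w y = 0) : w = (⟪w, y⟫ / ⟪y, y⟫) • y := by
  have hyy : 0 < ⟪y, y⟫ := by rw [real_inner_self_eq_norm_sq]; exact pow_pos (norm_pos_iff.2 hy) 2
  have hlag : ‖cross w y‖ ^ 2 = ⟪w, w⟫ * ⟪y, y⟫ - ⟪w, y⟫ ^ 2 := by
    rw [← real_inner_self_eq_norm_sq, CapSym.inner_cross_cross, real_inner_comm w y]; ring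
  rw [h, norm_zero] at hlag
  have key : ⟪w, w⟫ * ⟪y, y⟫ = ⟪w, y⟫ ^ 2 := by nlinarith [hlag]
  set c : ℝ := ⟪w, y⟫ / ⟪y, y⟫ with hc
  have hcy : c * ⟪y, y⟫ = ⟪w, y⟫ := div_mul_cancel₀ _ hyy.ne'
  have hzero : ⟪w - c • y, w - c • y⟫ = 0 := by
    have e : ⟪w - c • y, w - c • y⟫ = ⟪w, w⟫ - 2 * c * ⟪w, y⟫ + c * (c * ⟪y, y⟫) := by
      rw [inner_sub_left, inner_sub_right, inner_sub_right, real_inner_smul_left, real_inner_smul_right,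
        real_inner_smul_left, real_inner_smul_right, real_inner_comm w y]
      ring
    rw [e, hcy]
    -- `⟪w,w⟫ − c⟪w,y⟫ = (⟪w,w⟫⟪y,y⟫ − ⟪w,y⟫²)/⟪y,y⟫ = 0`
    have h2 : (⟪w, w⟫ - 2 * c * ⟪w, y⟫ + c * ⟪w, y⟫) * ⟪y, y⟫ = 0 := by
      have e2 : (⟪w, w⟫ - 2 * c * ⟪w, y⟫ + c * ⟪w, y⟫) * ⟪y, y⟫ = ⟪w, w⟫ * ⟪y, y⟫ - (c * ⟪y, y⟫) * ⟪w, y⟫ := by ring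
      rw [e2, hcy, key]; ring
    exact (mul_eq_zero.1 h2).resolve_right hyy.ne'
  have h0 : w - c • y = 0 := inner_self_eq_zero.1 hzero
  exact sub_eq_zero.1 h0

/-- `w × y = 0`, `y ≠ 0`, `τ ⊥ y` ⇒ `⟪w, τ⟫ = 0`. [folklore] -/
theorem inner_eq_zero_of_cross_eq_zero {w y τ : E3} (hy : y ≠ 0) (h : cross w y = 0) (hτ : ⟪y, τ⟫ = 0) : ⟪w, τ⟫ = 0 := by
  rw [eq_smul_of_cross_eq_zero hy h, real_inner_smul_left, hτ, mul_zero]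

/-! ### Great-circle calculus (`γ(s) = x₀ + c·(cos(θ₀ s) a + sin(θ₀ s) n × a)`) -/

/-- Derivative of the scaled great circle. [folklore] -/
theorem hasDerivAt_greatCircle (x₀ a n : E3) (θ₀ c s : ℝ) :
    HasDerivAt (fun σ : ℝ => x₀ + c • (Real.cos (θ₀ * σ) • a + Real.sin (θ₀ * σ) • cross n a))
      (c • (θ₀ • (-(Real.sin (θ₀ * s)) • a + Real.cos (θ₀ * s) • cross n a))) s := by
  have hθ : HasDerivAt (fun σ : ℝ => θ₀ * σ) θ₀ s := by
    simpa using (hasDerivAt_id s).const_mul θ₀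
  have h1 : HasDerivAt (fun σ : ℝ => Real.cos (θ₀ * σ) • a) ((-Real.sin (θ₀ * s) * θ₀) • a) s :=
    ((Real.hasDerivAt_cos (θ₀ * s)).comp s hθ).smul_const a
  have h2 : HasDerivAt (fun σ : ℝ => Real.sin (θ₀ * σ) • cross n a) ((Real.cos (θ₀ * s) * θ₀) • cross n a) s :=
    ((Real.hasDerivAt_sin (θ₀ * s)).comp s hθ).smul_const (cross n a)
  have h := ((h1.add h2).const_smul c).const_add x₀
  refine h.congr_deriv ?_
  module

/-- The scaled great circle lies on the sphere of radius `c‖a‖` (`n` unit, `n ⊥ a`, `c ≥ 0`). [folklore] -/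
theorem norm_greatCircle_sub_center {a n : E3} (hn : ‖n‖ = 1) (hna : ⟪n, a⟫ = 0) (x₀ : E3) (θ : ℝ) {c : ℝ} (hc : 0 ≤ c) :
    ‖x₀ + c • (Real.cos θ • a + Real.sin θ • cross n a) - x₀‖ = c * ‖a‖ := by
  have hna' : ⟪cross n a, a⟫ = 0 := Tao2016.inner_cross_self_right n a
  have hna'' : ⟪a, cross n a⟫ = 0 := by rw [real_inner_comm]; exact hna'
  have hcn : ‖cross n a‖ = ‖a‖ := norm_cross_of_unit_orth hn hna
  have hsq : ‖Real.cos θ • a + Real.sin θ • cross n a‖ ^ 2 = ‖a‖ ^ 2 := by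
    rw [← real_inner_self_eq_norm_sq, inner_add_left, inner_add_right, inner_add_right, real_inner_smul_left,
      real_inner_smul_right, real_inner_smul_left, real_inner_smul_right, real_inner_smul_left, real_inner_smul_right,
      real_inner_smul_left, real_inner_smul_right, hna', hna'', real_inner_self_eq_norm_sq, real_inner_self_eq_norm_sq, hcn]
    have := Real.cos_sq_add_sin_sq θ
    linear_combination ‖a‖ ^ 2 * this
  have hn0 : ‖Real.cos θ • a + Real.sin θ • cross n a‖ = ‖a‖ := by
    nlinarith [norm_nonneg (Real.cos θ • a + Real.sin θ • cross n a), norm_nonneg a, hsq,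
      sq_nonneg (‖Real.cos θ • a + Real.sin θ • cross n a‖ - ‖a‖)]
  rw [add_sub_cancel_left, norm_smul, Real.norm_of_nonneg hc, hn0]

/-- The velocity of the scaled great circle is tangent to the sphere: `⟪γ(s) − x₀, γ'(s)⟫ = 0`. [folklore] -/
theorem inner_greatCircle_tangent {a n : E3} (hn : ‖n‖ = 1) (hna : ⟪n, a⟫ = 0) (θ θ₀ c : ℝ) :
    ⟪c • (Real.cos θ • a + Real.sin θ • cross n a), c • (θ₀ • (-(Real.sin θ) • a + Real.cos θ • cross n a))⟫ = 0 := by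
  have hna' : ⟪cross n a, a⟫ = 0 := Tao2016.inner_cross_self_right n a
  have hna'' : ⟪a, cross n a⟫ = 0 := by rw [real_inner_comm]; exact hna'
  have hcn : ‖cross n a‖ = ‖a‖ := norm_cross_of_unit_orth hn hna
  have hcc : ⟪cross n a, cross n a⟫ = ⟪a, a⟫ := by
    rw [real_inner_self_eq_norm_sq, real_inner_self_eq_norm_sq, hcn]
  simp only [inner_add_left, inner_add_right, real_inner_smul_left, real_inner_smul_right,
    inner_neg_right, neg_smul, hna', hna'', hcc]
  ring

/-! ### The P-free representation: the head difference as a line integral along a path on the sphere -/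

/-- **Line-integral representation of the head difference.**  If `P, T ∈ C¹` off `x₀`, the tangential relation
`(∇P − ⟪w, x − x₀⟫∇T) × (x − x₀) = 0` holds off `x₀`, and `γ` is a `C¹` path avoiding `x₀` with `γ' ⊥ (γ − x₀)` (a path on a sphere about
`x₀`), then `P(γ 1) − P(γ 0) = ∫₀¹ ⟪w(γ), γ − x₀⟫ · DT(γ)[γ']`.  (`P` enters only through its endpoint values.) [folklore] -/
theorem headDiff_eq_lineIntegral {Pt Tt : E3 → ℝ} {vt : E3 → E3} (hP : ContDiffOn ℝ 1 Pt ({x₀}ᶜ : Set E3))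
    (htan : ∀ x, x ≠ x₀ → cross (gradient Pt x - ⟪vt x, x - x₀⟫ • gradient Tt x) (x - x₀) = 0)
    {γ γ' : ℝ → E3} (hγ : ∀ s, HasDerivAt γ (γ' s) s) (hγ'c : Continuous γ') (hne : ∀ s, γ s ≠ x₀)
    (horth : ∀ s, ⟪γ s - x₀, γ' s⟫ = 0) :
    Pt (γ 1) - Pt (γ 0) = ∫ s in (0 : ℝ)..1, ⟪vt (γ s), γ s - x₀⟫ * fderiv ℝ Tt (γ s) (γ' s) := by
  have hO : IsOpen ({x₀}ᶜ : Set E3) := isOpen_compl_singleton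
  have hγc : Continuous γ := continuous_iff_continuousAt.2 fun s => (hγ s).continuousAt
  have hPd : ∀ s, DifferentiableAt ℝ Pt (γ s) := fun s =>
    (hP.differentiableOn one_ne_zero _ (hne s)).differentiableAt (hO.mem_nhds (hne s))
  have hcomp : ∀ s, HasDerivAt (fun σ => Pt (γ σ)) (fderiv ℝ Pt (γ s) (γ' s)) s := fun s =>
    (hPd s).hasFDerivAt.comp_hasDerivAt s (hγ s)
  -- the integrand `DP(γ)[γ']` is continuous
  have hDc : Continuous fun s => fderiv ℝ Pt (γ s) :=
    (hP.continuousOn_fderiv_of_isOpen hO le_rfl).comp_continuous hγc fun s => hne s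
  have hIc : Continuous fun s => fderiv ℝ Pt (γ s) (γ' s) := hDc.clm_apply hγ'c
  have hftc := intervalIntegral.integral_eq_sub_of_hasDerivAt (a := (0 : ℝ)) (b := 1)
    (f := fun σ => Pt (γ σ)) (fun s _ => hcomp s) (hIc.intervalIntegrable 0 1)
  rw [← hftc]
  refine intervalIntegral.integral_congr fun s _ => ?_
  -- pointwise: `DP[γ'] = ⟪∇P, γ'⟫ = m ⟪∇T, γ'⟫`
  have hy : γ s - x₀ ≠ 0 := sub_ne_zero.2 (hne s)
  have h0 := inner_eq_zero_of_cross_eq_zero hy (htan (γ s) (hne s)) (horth s)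
  rw [inner_sub_left, real_inner_smul_left, sub_eq_zero] at h0
  have hgP : ⟪gradient Pt (γ s), γ' s⟫ = fderiv ℝ Pt (γ s) (γ' s) := by
    rw [gradient, InnerProductSpace.toDual_symm_apply]
  have hgT : ⟪gradient Tt (γ s), γ' s⟫ = fderiv ℝ Tt (γ s) (γ' s) := by
    rw [gradient, InnerProductSpace.toDual_symm_apply]
  show fderiv ℝ Pt (γ s) (γ' s) = ⟪vt (γ s), γ s - x₀⟫ * fderiv ℝ Tt (γ s) (γ' s)
  rw [← hgP, ← hgT, h0]

/-! ### The parametric line integral along rescaled great circles is jointly continuous -/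

/-- **Joint continuity of the rescaled line integrals**: for `v` smooth on the window, `T` smooth off the centre, a great-circle datum
`(a, n, θ₀)` on `S_r(x₀)` (`‖a‖ = r > 0`, `n` unit, `n ⊥ a`), the map
`(t',r') ↦ ∫₀¹ ⟪v(t',γ), γ − x₀⟫ · DT(t',·)(γ)[γ']`, `γ = x₀ + (r'/r)(cos(θ₀s) a + sin(θ₀s) n × a)`, is continuous on `]t₀,0[ × ]0,∞[`
(parametric integral of an integrand jointly continuous on the parameter subtype × `ℝ`). [folklore] -/
theorem continuousOn_lineIntegral (hv : ContDiffOn ℝ (⊤ : ℕ∞) (uncurry v) (Ioo t₀ 0 ×ˢ (univ : Set E3)))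
    (hT : ContDiffOn ℝ (⊤ : ℕ∞) (uncurry T) (Ioo t₀ 0 ×ˢ ({x₀}ᶜ : Set E3)))
    {a n : E3} (hn : ‖n‖ = 1) (hna : ⟪n, a⟫ = 0) {r : ℝ} (hr : 0 < r) (ha : ‖a‖ = r) (θ₀ : ℝ) :
    ContinuousOn (fun p : ℝ × ℝ => ∫ s in (0 : ℝ)..1,
        ⟪v p.1 (x₀ + (p.2 / r) • (Real.cos (θ₀ * s) • a + Real.sin (θ₀ * s) • cross n a)),
          (x₀ + (p.2 / r) • (Real.cos (θ₀ * s) • a + Real.sin (θ₀ * s) • cross n a)) - x₀⟫ *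
        fderiv ℝ (T p.1) (x₀ + (p.2 / r) • (Real.cos (θ₀ * s) • a + Real.sin (θ₀ * s) • cross n a))
          ((p.2 / r) • (θ₀ • (-(Real.sin (θ₀ * s)) • a + Real.cos (θ₀ * s) • cross n a))))
      (Ioo t₀ 0 ×ˢ Ioi 0) := by
  set D : Set (ℝ × ℝ) := Ioo t₀ 0 ×ˢ Ioi 0 with hD
  set W : Set (ℝ × E3) := Ioo t₀ 0 ×ˢ ({x₀}ᶜ : Set E3) with hWdef
  have hW : IsOpen W := isOpen_Ioo.prod isOpen_compl_singleton
  -- the arc and its velocity as continuous functions of `(p, s)`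
  set G : (ℝ × ℝ) × ℝ → E3 := fun q =>
    x₀ + (q.1.2 / r) • (Real.cos (θ₀ * q.2) • a + Real.sin (θ₀ * q.2) • cross n a) with hG
  set G' : (ℝ × ℝ) × ℝ → E3 := fun q =>
    (q.1.2 / r) • (θ₀ • (-(Real.sin (θ₀ * q.2)) • a + Real.cos (θ₀ * q.2) • cross n a)) with hG'
  have hGc : Continuous G := by
    simp only [hG]
    fun_prop
  have hG'c : Continuous G' := by
    simp only [hG']
    fun_prop
  have hGne : ∀ q : (ℝ × ℝ) × ℝ, 0 < q.1.2 → G q ≠ x₀ := by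
    intro q hq h0
    have h1 := norm_greatCircle_sub_center hn hna x₀ (θ₀ * q.2) (c := q.1.2 / r) (by positivity)
    have h2 : G q - x₀ = 0 := by rw [h0, sub_self]
    have h3 : ‖G q - x₀‖ = q.1.2 / r * ‖a‖ := h1
    rw [h2, norm_zero, ha] at h3
    have : 0 < q.1.2 / r * r := by positivity
    linarith
  -- the integrand on the subtype `D × ℝ`
  set F : ↥D × ℝ → ℝ := fun q =>
    ⟪v q.1.1.1 (G (q.1.1, q.2)), G (q.1.1, q.2) - x₀⟫ * fderiv ℝ (T q.1.1.1) (G (q.1.1, q.2)) (G' (q.1.1, q.2)) with hF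
  have hι : Continuous fun q : ↥D × ℝ => ((q.1 : ℝ × ℝ), q.2) :=
    (continuous_subtype_val.comp continuous_fst).prodMk continuous_snd
  have hGι : Continuous fun q : ↥D × ℝ => G ((q.1 : ℝ × ℝ), q.2) := hGc.comp hι
  have hG'ι : Continuous fun q : ↥D × ℝ => G' ((q.1 : ℝ × ℝ), q.2) := hG'c.comp hι
  have htι : Continuous fun q : ↥D × ℝ => (q.1 : ℝ × ℝ).1 :=
    continuous_fst.comp (continuous_subtype_val.comp continuous_fst)
  -- `v` part
  have hvc : Continuous fun q : ↥D × ℝ => v (q.1 : ℝ × ℝ).1 (G ((q.1 : ℝ × ℝ), q.2)) := by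
    have h := hv.continuousOn.comp_continuous (htι.prodMk hGι) fun q => ⟨q.1.2.1, mem_univ _⟩
    exact h
  -- `DT` part: `(t,y) ↦ D(T t)(y)` is continuous on `W`
  have hDT : ContinuousOn (fun q : ℝ × E3 => fderiv ℝ (fun y => uncurry T (q.1, y)) q.2) W :=
    (contDiffOn_fderiv_xslice hW hT).2.continuousOn
  have hDTc : Continuous fun q : ↥D × ℝ => fderiv ℝ (T (q.1 : ℝ × ℝ).1) (G ((q.1 : ℝ × ℝ), q.2)) := by
    have h := hDT.comp_continuous (htι.prodMk hGι) fun q => ⟨q.1.2.1, hGne _ q.1.2.2⟩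
    exact h
  have hFc : Continuous F := by
    simp only [hF]
    exact (hvc.inner (hGι.sub continuous_const)).mul (hDTc.clm_apply hG'ι)
  -- parametric integral on the subtype
  have hJ : Continuous fun p : ↥D => ∫ s in (0 : ℝ)..1, F (p, s) :=
    intervalIntegral.continuous_parametric_intervalIntegral_of_continuous' (f := fun p s => F (p, s)) hFc 0 1
  rw [continuousOn_iff_continuous_restrict]
  exact hJ

/-! ### (Δii) joint continuity of the head difference -/

/-- **(Δii) The extremal head difference is jointly continuous on `]t₀,0[ × ]0,∞[`.**  Data: `v` smooth on the window, `T` smooth off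
the centre, `P(t,·) ∈ C¹` off the centre with the tangential relation, the slice level-Lipschitz property in flexible form (every bound `L`
of `|⟪v(t,·), · − x₀⟫|` on `S_r(x₀)` is a constant), and property (i) of `I`.  See the module docstring for the proof. [folklore] -/
theorem continuousOn_headDiff_of_sliceLevelLip (hv : ContDiffOn ℝ (⊤ : ℕ∞) (uncurry v) (Ioo t₀ 0 ×ˢ (univ : Set E3)))
    (hT : ContDiffOn ℝ (⊤ : ℕ∞) (uncurry T) (Ioo t₀ 0 ×ˢ ({x₀}ᶜ : Set E3)))
    (hP1 : ∀ t ∈ Ioo t₀ 0, ContDiffOn ℝ 1 (P t) ({x₀}ᶜ : Set E3))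
    (htan : ∀ t ∈ Ioo t₀ 0, ∀ x, x ≠ x₀ →
      cross (gradient (P t) x - ⟪v t x, x - x₀⟫ • gradient (T t) x) (x - x₀) = 0)
    (hΛ : ∀ t ∈ Ioo t₀ 0, ∀ r > 0, ∀ L : ℝ, (∀ x ∈ Metric.sphere x₀ r, |⟪v t x, x - x₀⟫| ≤ L) →
      ∀ x ∈ Metric.sphere x₀ r, ∀ y ∈ Metric.sphere x₀ r, |P t x - P t y| ≤ L * |T t x - T t y|)
    {I : ℝ → ℝ → ℝ}
    (hI : ∀ t ∈ Ioo t₀ 0, ∀ r > 0, ∀ xp ∈ sphArgmax (T t) x₀ r, ∀ xm ∈ sphArgmin (T t) x₀ r, I t r = P t xp - P t xm) :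
    ContinuousOn (uncurry I) (Ioo t₀ 0 ×ˢ Ioi 0) := by
  set D : Set (ℝ × ℝ) := Ioo t₀ 0 ×ˢ Ioi 0 with hD
  rintro ⟨t, r⟩ ⟨ht, hr⟩
  have hr0 : 0 < r := hr
  have hTc : ∀ q ∈ D, ContinuousOn (T q.1) (Metric.sphere x₀ q.2) := fun q hq =>
    continuousOn_sphere_of_continuousOn_compl (continuousOn_slice_compl hT.continuousOn hq.1) hq.2
  have hp₀ : ((t, r) : ℝ × ℝ) ∈ D := ⟨ht, hr⟩
  -- extremisers at `(t, r)` and the great circle from `x⁻` to `x⁺`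
  obtain ⟨xp, hxp⟩ := exists_mem_sphArgmax (hTc (t, r) hp₀) hr0.le
  obtain ⟨xm, hxm⟩ := exists_mem_sphArgmin' (hTc (t, r) hp₀) hr0.le
  have ha : ‖xm - x₀‖ = r := mem_sphere_iff_norm.1 hxm.1
  have hb : ‖xp - x₀‖ = r := mem_sphere_iff_norm.1 hxp.1
  obtain ⟨n, θ₀, hn, hna, -, hbeq⟩ := exists_greatCircle hr0 ha hb
  -- the rescaled arcs, their endpoints, the line integral `J`
  set γ : ℝ × ℝ → ℝ → E3 := fun p s =>
    x₀ + (p.2 / r) • (Real.cos (θ₀ * s) • (xm - x₀) + Real.sin (θ₀ * s) • cross n (xm - x₀)) with hγ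
  set γ' : ℝ × ℝ → ℝ → E3 := fun p s =>
    (p.2 / r) • (θ₀ • (-(Real.sin (θ₀ * s)) • (xm - x₀) + Real.cos (θ₀ * s) • cross n (xm - x₀))) with hγ'
  set J : ℝ × ℝ → ℝ := fun p => ∫ s in (0 : ℝ)..1, ⟪v p.1 (γ p s), γ p s - x₀⟫ * fderiv ℝ (T p.1) (γ p s) (γ' p s)
    with hJ
  have hγ0 : ∀ p : ℝ × ℝ, γ p 0 = x₀ + (p.2 / r) • (xm - x₀) := fun p => by
    simp only [hγ, mul_zero, Real.cos_zero, Real.sin_zero, one_smul, zero_smul, add_zero]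
  have hγ1 : ∀ p : ℝ × ℝ, γ p 1 = x₀ + (p.2 / r) • (xp - x₀) := fun p => by
    simp only [hγ, mul_one]; rw [← hbeq]
  have hγS : ∀ p : ℝ × ℝ, 0 < p.2 → ∀ s, γ p s ∈ Metric.sphere x₀ p.2 := by
    intro p hp s
    rw [mem_sphere_iff_norm]
    have h := norm_greatCircle_sub_center hn hna x₀ (θ₀ * s) (c := p.2 / r) (by positivity)
    rw [ha] at h
    simp only [hγ]
    rw [h, div_mul_cancel₀ _ hr0.ne']
  have hγne : ∀ p : ℝ × ℝ, 0 < p.2 → ∀ s, γ p s ≠ x₀ := fun p hp s => ne_center_of_mem_sphere hp (hγS p hp s)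
  have hγd : ∀ p : ℝ × ℝ, ∀ s, HasDerivAt (γ p) (γ' p s) s := fun p s => hasDerivAt_greatCircle x₀ (xm - x₀) n θ₀ (p.2 / r) s
  have hγ'c : ∀ p : ℝ × ℝ, Continuous (γ' p) := fun p => by simp only [hγ']; fun_prop
  have hγorth : ∀ p : ℝ × ℝ, ∀ s, ⟪γ p s - x₀, γ' p s⟫ = 0 := fun p s => by
    simp only [hγ, hγ', add_sub_cancel_left]
    exact inner_greatCircle_tangent hn hna (θ₀ * s) θ₀ (p.2 / r)
  -- `J` is continuous on `D`, and `J p = P_{p.1}(x̃⁺) − P_{p.1}(x̃⁻)` on `D`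
  have hJc : ContinuousOn J D := continuousOn_lineIntegral hv hT hn hna hr0 ha θ₀
  have hJP : ∀ p ∈ D, P p.1 (x₀ + (p.2 / r) • (xp - x₀)) - P p.1 (x₀ + (p.2 / r) • (xm - x₀)) = J p := by
    intro p hp
    rw [← hγ0 p, ← hγ1 p]
    exact headDiff_eq_lineIntegral (hP1 p.1 hp.1) (htan p.1 hp.1) (hγd p) (hγ'c p) (hγne p hp.2) (hγorth p)
  -- a uniform bound `L₀` of `|⟪v(t',x), x − x₀⟫|` on the spheres `S_{r'}`, `(t',r')` near `(t,r)`
  set δ : ℝ := min ((t - t₀) / 2) (-t / 2) with hδ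
  have hδ0 : 0 < δ := lt_min (by linarith [ht.1]) (by linarith [ht.2])
  have hKt : Icc (t - δ) (t + δ) ⊆ Ioo t₀ 0 := fun s hs =>
    ⟨by linarith [hs.1, min_le_left ((t - t₀) / 2) (-t / 2)], by linarith [hs.2, min_le_right ((t - t₀) / 2) (-t / 2)]⟩
  have hKc : IsCompact (Icc (t - δ) (t + δ) ×ˢ Metric.closedBall x₀ (2 * r)) := isCompact_Icc.prod (isCompact_closedBall _ _)
  have hKW : Icc (t - δ) (t + δ) ×ˢ Metric.closedBall x₀ (2 * r) ⊆ Ioo t₀ 0 ×ˢ (univ : Set E3) := fun q hq =>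
    ⟨hKt hq.1, mem_univ _⟩
  obtain ⟨Mv, hMv⟩ := hKc.exists_bound_of_continuousOn (hv.continuousOn.mono hKW)
  set L₀ : ℝ := max Mv 0 * (2 * r) with hL₀
  have hL₀0 : 0 ≤ L₀ := by positivity
  set K : Set (ℝ × ℝ) := Icc (t - δ) (t + δ) ×ˢ Icc (r / 2) (2 * r) with hK
  have hKn : K ∈ 𝓝[D] ((t, r) : ℝ × ℝ) :=
    mem_nhdsWithin_of_mem_nhds (prod_mem_nhds (Icc_mem_nhds (by linarith) (by linarith)) (Icc_mem_nhds (by linarith) (by linarith)))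
  have hmL : ∀ p ∈ K, ∀ x ∈ Metric.sphere x₀ p.2, |⟪v p.1 x, x - x₀⟫| ≤ L₀ := by
    intro p hp x hx
    have hxn : ‖x - x₀‖ = p.2 := mem_sphere_iff_norm.1 hx
    have hxB : x ∈ Metric.closedBall x₀ (2 * r) := by
      rw [Metric.mem_closedBall, dist_eq_norm, hxn]; exact hp.2.2
    have h1 : ‖v p.1 x‖ ≤ max Mv 0 := (hMv (p.1, x) ⟨hp.1, hxB⟩).trans (le_max_left _ _)
    calc |⟪v p.1 x, x - x₀⟫| ≤ ‖v p.1 x‖ * ‖x - x₀‖ := abs_real_inner_le_norm _ _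
      _ ≤ max Mv 0 * (2 * r) := by
          rw [hxn]; exact mul_le_mul h1 hp.2.2 (le_of_lt (lt_of_lt_of_le (by positivity) hp.2.1)) (le_max_right _ _)
  -- extremisers at every `p ∈ D` (choice)
  have hexp : ∀ p : ℝ × ℝ, ∃ x : E3, p ∈ D → x ∈ sphArgmax (T p.1) x₀ p.2 := fun p => by
    by_cases hp : p ∈ D
    · obtain ⟨x, hx⟩ := exists_mem_sphArgmax (hTc p hp) (le_of_lt (show 0 < p.2 from hp.2))
      exact ⟨x, fun _ => hx⟩
    · exact ⟨x₀, fun h => absurd h hp⟩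
  have hexm : ∀ p : ℝ × ℝ, ∃ x : E3, p ∈ D → x ∈ sphArgmin (T p.1) x₀ p.2 := fun p => by
    by_cases hp : p ∈ D
    · obtain ⟨x, hx⟩ := exists_mem_sphArgmin' (hTc p hp) (le_of_lt (show 0 < p.2 from hp.2))
      exact ⟨x, fun _ => hx⟩
    · exact ⟨x₀, fun h => absurd h hp⟩
  choose Xp hXp using hexp
  choose Xm hXm using hexm
  -- the decomposition `I = J + E` on `D` and the bound `|E| ≤ B` on `D ∩ K`
  set E : ℝ × ℝ → ℝ := fun p =>
    (P p.1 (Xp p) - P p.1 (x₀ + (p.2 / r) • (xp - x₀))) + (P p.1 (x₀ + (p.2 / r) • (xm - x₀)) - P p.1 (Xm p)) with hE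
  set B : ℝ × ℝ → ℝ := fun p =>
    L₀ * ((sphSup (T p.1) x₀ p.2 - T p.1 (x₀ + (p.2 / r) • (xp - x₀)))
      + (T p.1 (x₀ + (p.2 / r) • (xm - x₀)) - sphInf (T p.1) x₀ p.2)) with hB
  have hdec : ∀ p ∈ D, uncurry I p = J p + E p := by
    intro p hp
    have h := hI p.1 hp.1 p.2 hp.2 (Xp p) (hXp p hp) (Xm p) (hXm p hp)
    show I p.1 p.2 = J p + E p
    rw [h, ← hJP p hp]
    simp only [hE]
    ring
  have hscaled : ∀ p ∈ D, ∀ (x : E3), ‖x - x₀‖ = r → x₀ + (p.2 / r) • (x - x₀) ∈ Metric.sphere x₀ p.2 := by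
    intro p hp x hx
    have hp2 : 0 ≤ p.2 := le_of_lt hp.2
    rw [mem_sphere_iff_norm, add_sub_cancel_left, norm_smul, hx, Real.norm_of_nonneg (div_nonneg hp2 hr0.le),
      div_mul_cancel₀ _ hr0.ne']
  have hEB : ∀ p ∈ D, p ∈ K → ‖E p‖ ≤ B p := by
    intro p hp hpK
    have hSLL := hΛ p.1 hp.1 p.2 hp.2 L₀ (hmL p hpK)
    have hxtp := hscaled p hp xp hb
    have hxtm := hscaled p hp xm ha
    have h1 := hSLL (Xp p) (hXp p hp).1 _ hxtp
    have h2 := hSLL _ hxtm (Xm p) (hXm p hp).1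
    have hle1 : T p.1 (x₀ + (p.2 / r) • (xp - x₀)) ≤ T p.1 (Xp p) := (hXp p hp).2 _ hxtp
    have hle2 : T p.1 (Xm p) ≤ T p.1 (x₀ + (p.2 / r) • (xm - x₀)) := (hXm p hp).2 _ hxtm
    have hsup : sphSup (T p.1) x₀ p.2 = T p.1 (Xp p) := sphSup_eq_of_mem_sphArgmax (hTc p hp) (hXp p hp)
    have hinf : sphInf (T p.1) x₀ p.2 = T p.1 (Xm p) := sphInf_eq_of_mem_sphArgmin (hTc p hp) (hXm p hp)
    rw [abs_of_nonneg (sub_nonneg.2 hle1)] at h1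
    rw [abs_of_nonneg (sub_nonneg.2 hle2)] at h2
    rw [Real.norm_eq_abs]
    simp only [hE, hB]
    rw [hsup, hinf, mul_add]
    exact (abs_add_le _ _).trans (add_le_add h1 h2)
  -- `B → 0` as `p → (t,r)` within `D`
  have hBc : ContinuousWithinAt B D (t, r) := by
    have hS := (continuousOn_sphSup_family (x₀ := x₀) hT.continuousOn) (t, r) hp₀
    have hIn := (continuousOn_sphInf_family (x₀ := x₀) hT.continuousOn) (t, r) hp₀
    have hTsl : ∀ {x : E3}, ‖x - x₀‖ = r →
        ContinuousWithinAt (fun p : ℝ × ℝ => T p.1 (x₀ + (p.2 / r) • (x - x₀))) D (t, r) := by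
      intro x hx
      have hmap : Continuous fun p : ℝ × ℝ => ((p.1, x₀ + (p.2 / r) • (x - x₀)) : ℝ × E3) := by fun_prop
      have h := hT.continuousOn.comp hmap.continuousOn (fun p hp => ⟨hp.1, ne_center_of_mem_sphere hp.2 (hscaled p hp x hx)⟩)
      exact h (t, r) hp₀
    simp only [hB]
    exact ((hS.sub (hTsl hb)).add ((hTsl ha).sub hIn)).const_mul L₀
  have hB0 : B (t, r) = 0 := by
    simp only [hB]
    rw [div_self hr0.ne', one_smul, one_smul, add_sub_cancel, add_sub_cancel,
      sphSup_eq_of_mem_sphArgmax (hTc (t, r) hp₀) hxp, sphInf_eq_of_mem_sphArgmin (hTc (t, r) hp₀) hxm]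
    ring
  have hBt : Tendsto B (𝓝[D] ((t, r) : ℝ × ℝ)) (𝓝 0) := by
    have h := hBc.tendsto
    rwa [hB0] at h
  have hEt : Tendsto E (𝓝[D] ((t, r) : ℝ × ℝ)) (𝓝 0) := by
    refine squeeze_zero_norm' ?_ hBt
    filter_upwards [hKn, self_mem_nhdsWithin] with p hpK hp using hEB p hp hpK
  -- conclude
  have hJt : Tendsto J (𝓝[D] ((t, r) : ℝ × ℝ)) (𝓝 (J (t, r))) := hJc (t, r) hp₀
  have hsum := hJt.add hEt
  rw [add_zero] at hsum
  have hval : uncurry I (t, r) = J (t, r) := by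
    rw [hdec (t, r) hp₀]
    have hE0 : E (t, r) = 0 := by
      have h1 := eq_of_mem_sphArgmax_of_sliceLevelLip (hΛ t ht r hr0 L₀ (hmL (t, r) (mem_of_mem_nhdsWithin hp₀ hKn)))
        (hXp (t, r) hp₀) hxp
      have h2 := eq_of_mem_sphArgmin_of_sliceLevelLip (hΛ t ht r hr0 L₀ (hmL (t, r) (mem_of_mem_nhdsWithin hp₀ hKn)))
        (hXm (t, r) hp₀) hxm
      simp only [hE]
      rw [div_self hr0.ne', one_smul, one_smul, add_sub_cancel, add_sub_cancel, h1, h2]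
      ring
    rw [hE0, add_zero]
  show Tendsto (uncurry I) (𝓝[D] ((t, r) : ℝ × ℝ)) (𝓝 (uncurry I (t, r)))
  rw [hval]
  exact hsum.congr' (by filter_upwards [self_mem_nhdsWithin] with p hp using (hdec p hp).symm)

end Summit.NavierStokesRegularity.NavierStokesRegularity.Theorems.PoloidalLiouville.NetFlux.NF1a

end
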